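import Mathlib
import HarnessLib
import Literature.Computability.AlgebraicComplexity.DTensorGaugePoints
import Summits.MatrixMultiplication.MatrixMultiplication.Theorems.OutsiderSandwichSliceGap
import Summits.MatrixMultiplication.MatrixMultiplication.Theorems.OutsiderSandwichPencilSharp

/-!
# OutsiderSandwich — the minimal slice layer of `D^{⊠N}` for every `N`
(decomp-mm lens 4 «minimal-counterexample / extremal reduction», gen 42, kernel K42-c; THESES-FREE,
DEFINITION-FREE — conventions of the pencil calculus: `D` is ANY tensor with
`hD : ∀ a b c, D a b c = if a ≠ b ∧ b ≠ c ∧ a ≠ c then 1 else 0`, the diagonalised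
Coppersmith–Winograd tensor `cw₂ ≅ D` over `ℂ`; `D(λ) = contract3 D λ`, `T_N(θ) = contract3 (D^{⊠N}) θ`.)

The slice gap of Part K39-a (`OutsiderSandwichSliceGap.exists_prod_of_rank_lt`: a covector of
slice rank `< 3·2^N` on words of length `N + 1` splits off a singular first letter) is iterated to
a complete description of the bottom of the slice-rank spectrum of `D^{⊠(N+1)}`, for EVERY `N`:

* `§1` singular `3 × 3` slices: `λ ≠ 0` with a vanishing coordinate has `rank D(λ) = 2`
  (`rank_dslice_eq_two`); `rank D(λ) ≤ 2` forces a vanishing coordinate (`exists_coord_eq_zero`).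
* `§2` Kronecker structure: `T_{N+1}(λ ⊗ ζ) ≅ D(λ) ⊗ₖ T_N(ζ)` (`slice_cons_submatrix`), hence
  `rank T_{N+1}(λ ⊗ ζ) = rank D(λ) · rank T_N(ζ)` (`rank_slice_cons`, via the tree's
  `DTensor.rank_kroneckerMap_mul`) and `rank T_N(λ₁ ⊗ ⋯ ⊗ λ_N) = ∏ rank D(λ_i)` (`rank_slice_prod`).
* `§3` **the minimal layer** (`exists_singular_prod_of_rank_lt`): a non-zero covector `θ` on words
  of length `N + 1` with `rank T_{N+1}(θ) < 3·2^N` is a full product `λ₀ ⊗ ⋯ ⊗ λ_N` of non-zero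
  letters each with a vanishing coordinate; consequently (`rank_eq_two_pow_of_rank_lt`) its rank is
  EXACTLY `2^{N+1}`: **the slice-rank spectrum of `D^{⊠(N+1)} ≅ cw₂^{⊠(N+1)}` meets the interval
  `[2^{N+1}, 3·2^N)` only in its left end-point**, the minimum `2^{N+1}` is attained precisely on the
  "singular Segre variety" of such products (`rank_eq_two_pow_iff`), and the next value `3·2^N` is
  attained (`exists_rank_eq_three_mul_two_pow`).  For `N + 1 = 2` this is the gap `{4} < 6` of K39-a
  used by the Segre transport of K42-a; for `N + 1 = 3` it is the gap `{8} < 12` (consistent with the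
  sampled spectrum `{8, 12, 14, 16, 17, …, 27}` of `D^{⊠3}`, this node's data).

Bearing on the cut (`closes … LaserTangency …`, necessity side = the packing census of
`⟨B⟩ ⊠ ⟨m,m,m⟩ ≤ cw₂^{⊠N}`): this is the classification input of every "transport into the minimal
layer" argument (K39-c `Q(cw₂^{⊠2}) = 6`, K42-a `2·⟨2,2,2⟩ ≰ cw₂^{⊠2}`), now available at all `N`.
Honest scope: by the pencil law the Sylvester slack of every census cell with `N ≥ 3` exceeds the
gap, so the minimal layer alone decides no further cell; it is the base case for the higher layers.

References: [cite: CoppersmithWinograd1990, §6]; [cite: BlaserIkenmeyerLysikovPandeySchreyer2019,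
Def. 13]; [cite: ChristandlVranaZuiddam2023, Example 1.4]; [cite: HornJohnson2013, §4.2].
-/

set_option linter.dupNamespace false

noncomputable section

namespace Summit.MatrixMultiplication.MatrixMultiplication.Theorems.OutsiderSandwichMinimalLayer

open Literature.Computability.AlgebraicComplexity
open Summit.MatrixMultiplication.MatrixMultiplication.Theorems.OutsiderSandwichPencilBlocks
open Summit.MatrixMultiplication.MatrixMultiplication.Theorems.OutsiderSandwichPencilSharp
  (slice_succ_prod rank_slice_single)
open Summit.MatrixMultiplication.MatrixMultiplication.Theorems.OutsiderSandwichSliceGap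
  (det_dslice two_le_rank_dslice exists_mulVec_eq_zero_of_coord rank_slice_one exists_prod_of_rank_lt)
open scoped Matrix BigOperators

variable {D : Fin 3 → Fin 3 → Fin 3 → ℂ}

/-! ## §1  Singular `3 × 3` slices -/

/-- A `3 × 3` complex matrix with a non-zero kernel vector has rank `≤ 2` (rank–nullity). [folklore] -/
theorem rank_le_two_of_mulVec_eq_zero {M : Matrix (Fin 3) (Fin 3) ℂ} {x : Fin 3 → ℂ} (hx0 : x ≠ 0)
    (hx : M *ᵥ x = 0) : M.rank ≤ 2 := by
  have hmem : x ∈ LinearMap.ker M.mulVecLin := by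
    rw [LinearMap.mem_ker, Matrix.mulVecLin_apply, hx]
  have hpos : 0 < Module.finrank ℂ (LinearMap.ker M.mulVecLin) :=
    Module.finrank_pos_iff_exists_ne_zero.mpr ⟨⟨x, hmem⟩, fun h => hx0 (congr_arg Subtype.val h)⟩
  have hsum := LinearMap.finrank_range_add_finrank_ker M.mulVecLin
  rw [Module.finrank_fin_fun] at hsum
  unfold Matrix.rank
  omega

/-- **Singular letters have rank exactly `2`**: `λ ≠ 0` with a vanishing coordinate has
`rank D(λ) = 2` (`det D(λ) = 2λ₀λ₁λ₂ = 0` and minrank `2`). [cite: CoppersmithWinograd1990, §6] -/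
theorem rank_dslice_eq_two (hD : ∀ a b c, D a b c = if a ≠ b ∧ b ≠ c ∧ a ≠ c then 1 else 0)
    {lam : Fin 3 → ℂ} (hlam : lam ≠ 0) {a : Fin 3} (ha : lam a = 0) : (contract3 D lam).rank = 2 := by
  obtain ⟨x, hx0, hx⟩ := exists_mulVec_eq_zero_of_coord hD a ha
  exact le_antisymm (rank_le_two_of_mulVec_eq_zero hx0 hx) (two_le_rank_dslice hD hlam)

/-- A letter of slice rank `≤ 2` has a vanishing coordinate (`det D(λ) = 2λ₀λ₁λ₂`).
[cite: CoppersmithWinograd1990, §6] -/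
theorem exists_coord_eq_zero (hD : ∀ a b c, D a b c = if a ≠ b ∧ b ≠ c ∧ a ≠ c then 1 else 0)
    {lam : Fin 3 → ℂ} (hr : (contract3 D lam).rank ≤ 2) : ∃ a, lam a = 0 := by
  by_contra h
  push Not at h
  have hdet : IsUnit (contract3 D lam).det := by
    rw [det_dslice hD, isUnit_iff_ne_zero]
    exact mul_ne_zero (mul_ne_zero (mul_ne_zero two_ne_zero (h 0)) (h 1)) (h 2)
  have h3 := Matrix.rank_of_isUnit _ ((Matrix.isUnit_iff_isUnit_det _).mpr hdet)
  simp only [Fintype.card_fin] at h3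
  omega

/-! ## §2  Kronecker structure of product slices -/

/-- **`T_{N+1}(λ ⊗ ζ) ≅ D(λ) ⊗ₖ T_N(ζ)`** (reindexing words of length `N + 1` by
`Fin.consEquiv`). [cite: HornJohnson2013, §4.2] -/
theorem slice_cons_submatrix (N : ℕ) (lam : Fin 3 → ℂ) (ζ : (Fin N → Fin 3) → ℂ) :
    (contract3 (kroneckerPow D (N + 1)) (fun f => lam (f 0) * ζ (Fin.tail f))).submatrix
        (Fin.consEquiv fun _ => Fin 3) (Fin.consEquiv fun _ => Fin 3) =
      Matrix.kroneckerMap (· * ·) (contract3 D lam) (contract3 (kroneckerPow D N) ζ) := by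
  have hcomp : ∀ d : Fin 3, (fun v : Fin N → Fin 3 =>
      (fun f : Fin (N + 1) → Fin 3 => lam (f 0) * ζ (Fin.tail f)) (Fin.cons d v)) = lam d • ζ := by
    intro d; funext v; simp
  ext ⟨b, w⟩ ⟨c, w'⟩
  rw [Matrix.submatrix_apply, Matrix.kroneckerMap_apply]
  have he : ∀ p : Fin 3 × (Fin N → Fin 3), (Fin.consEquiv fun _ => Fin 3) p = Fin.cons p.1 p.2 :=
    fun _ => rfl
  rw [he, he, slice_succ_prod N _ lam ζ hcomp]
  simp only [Fin.cons_zero, Fin.tail_cons, contract3_apply]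

/-- **Multiplicativity**: `rank T_{N+1}(λ ⊗ ζ) = rank D(λ) · rank T_N(ζ)`.
[cite: ChristandlVranaZuiddam2023, Example 1.4] [cite: HornJohnson2013, §4.2] -/
theorem rank_slice_cons (N : ℕ) (lam : Fin 3 → ℂ) (ζ : (Fin N → Fin 3) → ℂ) :
    (contract3 (kroneckerPow D (N + 1)) (fun f => lam (f 0) * ζ (Fin.tail f))).rank =
      (contract3 D lam).rank * (contract3 (kroneckerPow D N) ζ).rank := by
  rw [← DTensor.rank_kroneckerMap_mul, ← slice_cons_submatrix N lam ζ, Matrix.rank_submatrix]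

/-- **Full products**: `rank T_N(λ₀ ⊗ ⋯ ⊗ λ_{N-1}) = ∏ᵢ rank D(λᵢ)`.
[cite: ChristandlVranaZuiddam2023, Example 1.4] -/
theorem rank_slice_prod : ∀ (N : ℕ) (lam : Fin N → Fin 3 → ℂ),
    (contract3 (kroneckerPow D N) (fun w => ∏ i, lam i (w i))).rank =
      ∏ i, (contract3 D (lam i)).rank := by
  intro N
  induction N with
  | zero =>
    intro lam
    simp only [Finset.univ_eq_empty, Finset.prod_empty]
    exact rank_slice_zero (by intro h; simpa using congr_fun h fun i => Fin.elim0 i)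
  | succ N ih =>
    intro lam
    have hθ : (fun w : Fin (N + 1) → Fin 3 => ∏ i, lam i (w i)) =
        fun f => lam 0 (f 0) * (fun v : Fin N → Fin 3 => ∏ j, lam j.succ (v j)) (Fin.tail f) := by
      funext w
      rw [Fin.prod_univ_succ]
      rfl
    have hc := rank_slice_cons (D := D) N (lam 0) (fun v : Fin N → Fin 3 => ∏ j, lam j.succ (v j))
    rw [hθ, hc, ih (fun j => lam j.succ), Fin.prod_univ_succ]

/-! ## §3  The minimal layer -/

/-- **The minimal slice layer of `D^{⊠(N+1)}`.**  A non-zero covector `θ` on words of length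
`N + 1` with `rank T_{N+1}(θ) < 3 · 2^N` is a full product `θ = λ₀ ⊗ ⋯ ⊗ λ_N` of non-zero letters
each having a vanishing coordinate (iterate the splitting lemma of K39-a).
[cite: CoppersmithWinograd1990, §6] -/
theorem exists_singular_prod_of_rank_lt
    (hD : ∀ a b c, D a b c = if a ≠ b ∧ b ≠ c ∧ a ≠ c then 1 else 0) :
    ∀ (N : ℕ) (θ : (Fin (N + 1) → Fin 3) → ℂ), θ ≠ 0 →
      (contract3 (kroneckerPow D (N + 1)) θ).rank < 3 * 2 ^ N →
      ∃ lam : Fin (N + 1) → Fin 3 → ℂ, (∀ i, lam i ≠ 0 ∧ ∃ a, lam i a = 0) ∧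
        θ = fun w => ∏ i, lam i (w i) := by
  intro N
  induction N with
  | zero =>
    intro θ hθ hr
    have hθeq : θ = fun w => ∏ i : Fin (0 + 1),
        (fun _ : Fin (0 + 1) => fun c : Fin 3 => θ fun _ : Fin 1 => c) i (w i) := by
      funext w
      rw [Fin.prod_univ_succ, Fin.prod_univ_zero, mul_one]
      exact congr_arg θ (funext fun i => congr_arg w
        (by rw [Fin.ext_iff, Fin.val_zero]; have := i.isLt; omega))
    have hr' : (contract3 (kroneckerPow D 1) θ).rank < 3 := by simpa using hr
    have hrk : (contract3 D fun c : Fin 3 => θ fun _ : Fin 1 => c).rank ≤ 2 := by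
      have := rank_slice_one (D := D) θ
      omega
    obtain ⟨a, ha⟩ := exists_coord_eq_zero hD hrk
    have hne : (fun c : Fin 3 => θ fun _ : Fin 1 => c) ≠ 0 := by
      intro h
      apply hθ
      rw [hθeq]
      funext w
      have h' := congr_fun h (w 0)
      simp only [Pi.zero_apply] at h'
      simp [h']
    exact ⟨fun _ => fun c => θ fun _ : Fin 1 => c, fun _ => ⟨hne, a, ha⟩, hθeq⟩
  | succ N ih =>
    intro θ hθ hr
    obtain ⟨lam, ζ, a, hlam, hζ, hprod, hrk⟩ := exists_prod_of_rank_lt hD (N + 1) θ hθ hr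
    have hrζ : (contract3 (kroneckerPow D (N + 1)) ζ).rank < 3 * 2 ^ N := by
      rw [pow_succ] at hr
      omega
    obtain ⟨lam', hlam', hζeq⟩ := ih ζ hζ hrζ
    have hne : lam ≠ 0 := by
      intro h
      apply hθ
      rw [hprod]
      funext w
      simp [h]
    refine ⟨Fin.cons lam lam', fun i => ?_, ?_⟩
    · refine Fin.cases ?_ (fun j => ?_) i
      · simpa using ⟨hne, a, hlam⟩
      · simpa using hlam' j
    · rw [hprod, hζeq]
      funext w
      rw [Fin.prod_univ_succ]
      simp only [Fin.cons_zero, Fin.cons_succ]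
      rfl

/-- Products of non-zero singular letters have slice rank exactly `2^N`.
[cite: CoppersmithWinograd1990, §6] -/
theorem rank_singular_prod (hD : ∀ a b c, D a b c = if a ≠ b ∧ b ≠ c ∧ a ≠ c then 1 else 0)
    (N : ℕ) (lam : Fin N → Fin 3 → ℂ) (h : ∀ i, lam i ≠ 0 ∧ ∃ a, lam i a = 0) :
    (contract3 (kroneckerPow D N) (fun w => ∏ i, lam i (w i))).rank = 2 ^ N := by
  rw [rank_slice_prod N lam, Finset.prod_eq_pow_card (b := 2), Finset.card_univ, Fintype.card_fin]
  intro i _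
  obtain ⟨hne, a, ha⟩ := h i
  exact rank_dslice_eq_two hD hne ha

/-- **The slice gap at every length.**  A non-zero covector on words of length `N + 1` with
`rank T_{N+1}(θ) < 3 · 2^N` has rank EXACTLY `2^{N+1}`: the slice-rank spectrum of `D^{⊠(N+1)}`
(equivalently of `cw₂^{⊠(N+1)}`) contains no value strictly between `2^{N+1}` and `3 · 2^N`.
[cite: CoppersmithWinograd1990, §6] -/
theorem rank_eq_two_pow_of_rank_lt (hD : ∀ a b c, D a b c = if a ≠ b ∧ b ≠ c ∧ a ≠ c then 1 else 0)
    (N : ℕ) (θ : (Fin (N + 1) → Fin 3) → ℂ) (hθ : θ ≠ 0)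
    (hr : (contract3 (kroneckerPow D (N + 1)) θ).rank < 3 * 2 ^ N) :
    (contract3 (kroneckerPow D (N + 1)) θ).rank = 2 ^ (N + 1) := by
  obtain ⟨lam, hlam, hθeq⟩ := exists_singular_prod_of_rank_lt hD N θ hθ hr
  rw [hθeq]
  exact rank_singular_prod hD (N + 1) lam hlam

/-- No slice of `D^{⊠(N+1)}` has rank in the open interval `(2^{N+1}, 3 · 2^N)`.
[cite: CoppersmithWinograd1990, §6] -/
theorem not_rank_mem_gap (hD : ∀ a b c, D a b c = if a ≠ b ∧ b ≠ c ∧ a ≠ c then 1 else 0)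
    (N : ℕ) (θ : (Fin (N + 1) → Fin 3) → ℂ) :
    ¬ (2 ^ (N + 1) < (contract3 (kroneckerPow D (N + 1)) θ).rank ∧
        (contract3 (kroneckerPow D (N + 1)) θ).rank < 3 * 2 ^ N) := by
  rintro ⟨h1, h2⟩
  by_cases hθ : θ = 0
  · subst hθ
    rw [slice_zero, Matrix.rank_zero] at h1
    exact absurd h1 (not_lt.mpr (Nat.zero_le _))
  · have := rank_eq_two_pow_of_rank_lt hD N θ hθ h2
    omega

/-- **Characterisation of the minimal layer.**  For a non-zero covector `θ` on words of length
`N + 1`: `rank T_{N+1}(θ) = 2^{N+1}` iff `θ` is a product of non-zero letters each with a vanishing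
coordinate (the "singular Segre variety"). [cite: CoppersmithWinograd1990, §6] -/
theorem rank_eq_two_pow_iff (hD : ∀ a b c, D a b c = if a ≠ b ∧ b ≠ c ∧ a ≠ c then 1 else 0)
    (N : ℕ) (θ : (Fin (N + 1) → Fin 3) → ℂ) (hθ : θ ≠ 0) :
    (contract3 (kroneckerPow D (N + 1)) θ).rank = 2 ^ (N + 1) ↔
      ∃ lam : Fin (N + 1) → Fin 3 → ℂ, (∀ i, lam i ≠ 0 ∧ ∃ a, lam i a = 0) ∧
        θ = fun w => ∏ i, lam i (w i) := by
  constructor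
  · intro h
    refine exists_singular_prod_of_rank_lt hD N θ hθ ?_
    rw [h, pow_succ]
    have : 0 < 2 ^ N := pow_pos two_pos N
    omega
  · rintro ⟨lam, hlam, rfl⟩
    exact rank_singular_prod hD (N + 1) lam hlam

/-- **The gap is exact**: the value `3 · 2^N` is attained, by `𝟙 ⊗ e_0 ⊗ ⋯ ⊗ e_0`
(`rank D(𝟙) = 3` since `det D(𝟙) = 2`, times `N` coordinate letters of rank `2`).
[cite: BlaserIkenmeyerLysikovPandeySchreyer2019, Def. 13] -/
theorem exists_rank_eq_three_mul_two_pow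
    (hD : ∀ a b c, D a b c = if a ≠ b ∧ b ≠ c ∧ a ≠ c then 1 else 0) (N : ℕ) :
    ∃ θ : (Fin (N + 1) → Fin 3) → ℂ, (contract3 (kroneckerPow D (N + 1)) θ).rank = 3 * 2 ^ N := by
  let lam : Fin (N + 1) → Fin 3 → ℂ :=
    Fin.cons (fun _ => 1) (fun _ c => if c = 0 then 1 else 0)
  refine ⟨fun w => ∏ i, lam i (w i), ?_⟩
  rw [rank_slice_prod (N + 1) lam, Fin.prod_univ_succ]
  have h1 : (contract3 D (lam 0)).rank = 3 := by
    have hdet : IsUnit (contract3 D (lam 0)).det := by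
      rw [det_dslice hD, isUnit_iff_ne_zero]
      simp [lam]
    have := Matrix.rank_of_isUnit _ ((Matrix.isUnit_iff_isUnit_det _).mpr hdet)
    simpa using this
  have h2 : ∀ j : Fin N, (contract3 D (lam j.succ)).rank = 2 := fun j =>
    rank_dslice_eq_two hD (a := 1) (by intro h; simpa [lam] using congr_fun h 0) (by simp [lam])
  rw [h1, Finset.prod_congr rfl fun j _ => h2 j, Finset.prod_const, Finset.card_univ,
    Fintype.card_fin]

end Summit.MatrixMultiplication.MatrixMultiplication.Theorems.OutsiderSandwichMinimalLayer
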